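import Summits.HodgeConjecture.HodgeConjecture.Theorems.Ring2AbelianAllSpreadPrimitiveMiddle
import Summits.HodgeConjecture.HodgeConjecture.Theorems.Ring2ClassTargetsRows
import Literature.AlgebraicGeometry.HodgeTheory.WeilClassesFourfoldsFromSixfoldsHolds
import HarnessLib

/-!
# Ring 2 around `HC_CM` — AbelianAll / SPREAD axis, part XXIX: the primitive-middle normal form LAYER BY LAYER; the
fourfold layer IS Hodge for abelian fourfolds, so the first layer not decided by the rows `g ≤ 5` is the SIXFOLD one

HONEST FRAMING (page 1, verbatim in every file of this cell): research route, not a corollary; conditional on HC_CM plus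
one named minimal statement. (Cell line: research route conditional on HC_CM; not a corollary; Q11.4-sentence-2 already
refuted in dim ≥ 3.)

`HC_CM` := `Theses.RankFourFaces.CMAbelianHodge` (item stmt-HodgeConjecture-3052) is OPEN and is only ever a HYPOTHESIS
below (§4), by name. `HC_AV` := `Theses.PadicSemiregularLift.HodgeAbelianVarieties` (stmt-1333) and `CMToAbelian`
(stmt-16267) are OPEN route items, by name; nothing here decides them. NO node, NO `def`, NO new named fact, NO `sorry`:
every shape below is a display-only `local notation3` (census-invisible by design, as in part XXVIII). The B_min OF RECORD
of this axis is unchanged (`MiddleHodgeFailureSpreadsToCMFibre`, part XXIV, census N104); "minimal" / "strictly weaker" is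
claimed for NOTHING in this file.

Part XXVIII (`HC_AV_iff_forall_primitiveMiddle`) put `HC_AV` in the normal form "every rational `(m,m)` Λ-PRIMITIVE class in
the MIDDLE degree of every complex abelian variety of dimension `2m ≥ 4` is algebraic". Write `PM⦃≤M⦄` for the layers
`2 ≤ m ≤ M`, `PM⦃=M⦄` for the layer `m = M`, `PM⦃≥M⦄` for the layers `m ≥ M` (§0). Kernel rows, fact-free unless displayed:
* §1–§2 LAYER CALCULUS (part XXVIII §1 with the dimension bound threaded through ring2-b02's one-step lift `A ↦ A × E`):
  `HCUpToDim (2M) → PM⦃≤M⦄ → HCUpToDim (M + 2)` (`Ring2.ClassTargets.HCUpToDim g` = Hodge for all complex abelian varieties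
  of dimension `≤ g`, typer 1's frame); hence **`HCUpToDim 4 ↔ PM⦃=2⦄`** (Hodge for abelian FOURFOLDS is exactly the
  fourfold layer) and `PM⦃≤3⦄ → HCUpToDim 5` (the fourfold and SIXFOLD layers give every abelian variety of dimension
  `≤ 5`: on the level of USE the sixfold layer replaces Moonen–Zarhin's fivefold classification Thm. 0.2; it does not
  reprove it).
* §3 THE FIRST OPEN LAYER: **`HC_AV ↔ HCAtDim 4 ∧ PM⦃≥3⦄`** fact-free; modulo the ONE refereed classification fact
  `MoonenZarhin1999_codimTwoHodgeClasses_abelianFourfold` (Math. Ann. 315 (1999) Thm. 0.1, displayed as `h01`; typer 1's row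
  `hcUpToDim_four_iff_weilClassesFourfolds`) **`HC_AV ↔ Markman2025_weilClasses_algebraic_abelianFourfold ∧ PM⦃≥3⦄`**: Hodge
  for ALL complex abelian varieties is the Weil-FOURFOLD cell (hodge-weil rung R1; arXiv:2502.03415 Cor. 1.6.1, UNREFEREED
  for general discriminant — refereed: `det H = 1` Markman 2023, general member for `K = ℚ(√-3)` Schoen 1988 / van Geemen
  1994 §7.1–7.2, `K = ℚ(i)` van Geemen §7.4) AND the primitive middle layers in EVEN dimension `≥ 6`; odd dimensions,
  non-primitive classes, non-middle degrees, Moonen–Zarhin Thm. 0.2 and Tankeev–Ribet are eliminated FACT-FREE (contrast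
  typer 1's `Ring2ClassTargetsRows`: three classification facts for the rows `g ≤ 7`). With the hodge-weil ladder's finest
  inputs (`Markman2025_weilClasses_algebraic_abelianFourfold_holds_of`, rung F0c a tree theorem): `HC_AV ↔ PM⦃≥3⦄` modulo
  `h01`, Markman's hyperbolic SIXFOLDS of discriminant `-1` (Thm. 1.5.1, UNREFEREED) and Schoen 1998 §10 — displayed.
* §4 THE FLOOR READ ON THE FIRST OPEN LAYER (`HC_CM` enters here only): with `F_CM⦃prim,mid,≥3⦄` := part XXVIII's display
  shape restricted to `m ≥ 3`, `HC_AV ↔ HCAtDim 4 ∧ (HC_CM ∧ F_CM⦃prim,mid,≥3⦄)` fact-free, and with the Weil-fourfold cell in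
  place of `HCAtDim 4` modulo `h01` — the brief's shape `HC_CM → B → HC_AV`; N104 ⟹ the new shape (forget), so nothing here
  is a new floor and nothing is claimed minimal.

In print: "The Hodge conjecture for abelian varieties of dimension ≤ 5 is known to follow from [the Weil classes on all
abelian fourfolds of Weil type]" (Markman, arXiv:2509.23403 p. 2 and Cor. 1.3); for sixfolds print decides the Weil classes
in the SPLIT Weil-type case only (ibid. Thm. 1.2) — the layer `PM⦃=3⦄` is open in print and in the tree (hodge-weil rungs R1′,
R6). Count once: rows `g = 4, 5` and the frame `HCAtDim`/`HCUpToDim` are typer 1's (`Ring2ClassTargets*`), the one-step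
primitive lift is ring2-b02's (`Ring2BindersAbelianSchemeVHCPrimitiveMiddleLift`, its `(6,3)` threshold for row b02), the
Weil-fourfold cell and its sixfold inputs are the hodge-weil ladder's; this file only reads part XXVIII's normal form
against them.
-/

open CategoryTheory AlgebraicGeometry MonoidalCategory CartesianMonoidalCategory
open Literature.AlgebraicGeometry Literature.AlgebraicGeometry.Motives
open Literature.AlgebraicGeometry.HodgeTheory
open Literature.AlgebraicTopology.SingularHomology
open Literature.Geometry.Kaehler (lefschetzOperator)

set_option linter.dupNamespace false

namespace Summit.HodgeConjecture.HodgeConjecture.Ring2.AbelianAll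

open Summit.HodgeConjecture.HodgeConjecture
open Summit.HodgeConjecture.HodgeConjecture.Theorems
open Summit.HodgeConjecture.HodgeConjecture.Theses
open Summit.HodgeConjecture.HodgeConjecture.Theses.RankFourFaces (CMAbelianHodge CMToAbelian)
open Summit.HodgeConjecture.HodgeConjecture.Theses.PadicSemiregularLift (HodgeAbelianVarieties)
open Summit.HodgeConjecture.HodgeConjecture.Ring2.Deform (cmLocus)
open Summit.HodgeConjecture.HodgeConjecture.Ring2.ClassTargets (HCAtDim HCUpToDim hcUpToDim_iff_hcAtDim hcUpToDim_mono
  hcUpToDim_of_hcAtDim hcAtDim_of_hcUpToDim hcUpToDim_four_iff_weilClassesFourfolds hcOnClass_of_hodgeAbelianVarieties)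
open Summit.HodgeConjecture.HodgeConjecture.Ring2.Binders (map_mem_primitiveClasses primitiveLift_mem_primitiveClasses
  isRationalClass_primitiveLift isOfHodgeType_primitiveLift mem_algebraicClasses_of_primitiveLift_mem)

/-! ## §0 The layers of the primitive-middle normal form (display-only shapes, NO `def`) -/
/-- Display-only (NO `def`): the layers `2 ≤ m ≤ M` of part XXVIII's normal form — every rational `(m,m)` Λ-primitive
middle-degree class on a complex abelian variety of dimension `2m`, `2 ≤ m ≤ M`, is algebraic. -/
local notation3 (prettyPrint := false) "PM⦃≤" M "⦄" =>
  ∀ (A : AbelianVariety ℂ) (Λ : HardLefschetzNFold (AbelianVariety.dim A) (AbelianVariety.X A)) (m : ℕ), 2 ≤ m → m ≤ M →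
    AbelianVariety.dim A = 2 * m →
      ∀ (c : complexBetti (AbelianVariety.X A) (2 * m)), IsRationalClass c →
        IsOfHodgeType (AbelianVariety.dim A) (AbelianVariety.X A) (2 * m) m m c →
          c ∈ primitiveClasses (HardLefschetzNFold.hyperplaneClass Λ) (AbelianVariety.dim A) (2 * m) →
            c ∈ algebraicClasses (AbelianVariety.X A) m

/-- Display-only (NO `def`): the layers `m ≥ M` (and `m ≥ 2`). -/
local notation3 (prettyPrint := false) "PM⦃≥" M "⦄" =>
  ∀ (A : AbelianVariety ℂ) (Λ : HardLefschetzNFold (AbelianVariety.dim A) (AbelianVariety.X A)) (m : ℕ), 2 ≤ m → M ≤ m →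
    AbelianVariety.dim A = 2 * m →
      ∀ (c : complexBetti (AbelianVariety.X A) (2 * m)), IsRationalClass c →
        IsOfHodgeType (AbelianVariety.dim A) (AbelianVariety.X A) (2 * m) m m c →
          c ∈ primitiveClasses (HardLefschetzNFold.hyperplaneClass Λ) (AbelianVariety.dim A) (2 * m) →
            c ∈ algebraicClasses (AbelianVariety.X A) m

/-- Display-only (NO `def`): the single layer `m = M`. -/
local notation3 (prettyPrint := false) "PM⦃=" M "⦄" =>
  ∀ (A : AbelianVariety ℂ) (Λ : HardLefschetzNFold (AbelianVariety.dim A) (AbelianVariety.X A)),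
    AbelianVariety.dim A = 2 * M →
      ∀ (c : complexBetti (AbelianVariety.X A) (2 * M)), IsRationalClass c →
        IsOfHodgeType (AbelianVariety.dim A) (AbelianVariety.X A) (2 * M) M M c →
          c ∈ primitiveClasses (HardLefschetzNFold.hyperplaneClass Λ) (AbelianVariety.dim A) (2 * M) →
            c ∈ algebraicClasses (AbelianVariety.X A) M

/-! ## §1 Localised defect induction (fact-free, `HC_CM`-free) -/
/-- **LOCALISED DEFECT INDUCTION** (part XXVIII §1 with the bound `M` threaded): if on every complex abelian variety `B` of
dimension `2m` with `2 ≤ m ≤ M` and for every polarisation class `θ` every rational `(m,m)` class in `P^{2m}(B, θ)` is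
algebraic, then for every defect `d`, every smooth projective `X ≅ A` abelian of dimension `n`, every polarisation class `η`,
every `p ≥ 2` with `2p + d = n` AND `p + d ≤ M`, every rational `(p,p)` class in `P^{2p}(X, η)` is algebraic. Induction on `d`
along ring2-b02's one-step lift on `X × E` (`E` an elliptic curve), which raises `p` and the dimension by one and lowers the
defect by one, so the layer finally used is `m = p + d ≤ M`. [cite: VoisinHodgeI2002, §6.2.3 Def. 6.24, Cor. 6.26 and
Rem. 6.27] [cite: Kleiman1968AlgebraicCycles, §1.4 and Thm. 2A11] [cite: Lieberman1968, main theorem]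
[cite: BrosnanFangNiePearlstein2009, §6 Lemma 48] -/
theorem mem_algebraicClasses_of_mem_primitiveClasses_of_primitiveMiddle_le (M : ℕ)
    (hpm : ∀ (B : AbelianVariety ℂ) (m : ℕ), 2 ≤ m → m ≤ M → B.dim = 2 * m →
      ∀ (θ : complexBetti B.X 2), IsPolarizationClass B.dim B.X θ →
        ∀ z : complexBetti B.X (2 * m), IsRationalClass z → IsOfHodgeType B.dim B.X (2 * m) m m z →
          z ∈ primitiveClasses θ B.dim (2 * m) → z ∈ algebraicClasses B.X m) :
    ∀ (d : ℕ) {X : SchemeOver ℂ} {n : ℕ}, IsSmoothProjective n X → ∀ (A : AbelianVariety ℂ), A.dim = n → (A.X ≅ X) →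
      ∀ {η : complexBetti X 2}, IsPolarizationClass n X η → ∀ {p : ℕ}, 2 ≤ p → 2 * p + d = n → p + d ≤ M →
        ∀ (c : complexBetti X (2 * p)), IsRationalClass c → IsOfHodgeType n X (2 * p) p p c →
          c ∈ primitiveClasses η n (2 * p) → c ∈ algebraicClasses X p := by
  intro d
  induction d with
  | zero =>
    intro X n hX A hA eA η hη p h2 hn hM c hc hpp hprim
    subst hA
    have hAX : IsSmoothProjective A.dim A.X := AbelianVariety.isSmoothProjective_holds
    -- transport `c`, `η` along `eA : A ≅ X` and apply the hypothesis on `A` itself (`dim A = 2p`, layer `m = p ≤ M`)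
    have hz := hpm A p h2 (by omega) (by omega) (complexBetti.map eA.hom 2 η) (hη.map_of_iso hX hAX eA)
      (complexBetti.map eA.hom (2 * p) c) ((isRationalClass_map_iff_of_iso eA).2 hc)
      ((isOfHodgeType_map_iff_of_iso eA).2 hpp) (map_mem_primitiveClasses eA.hom hprim)
    exact (mem_algebraicClasses_map_iff_of_iso eA).1 hz
  | succ r ih =>
    intro X n hX A hA eA η hη p h2 hn hM c hc hpp hprim
    -- an elliptic curve `E` with a polarisation class `K_E`; `X × E ≅ (A × E).X`, of dimension `n + 1`
    obtain ⟨E, hE1⟩ := exists_abelianVariety_dim_eq_one ℂ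
    have hE : IsSmoothProjective E.dim E.X := AbelianVariety.isSmoothProjective_holds
    obtain ⟨K_E, hKE⟩ := exists_isPolarizationClass hE
    have hX' : IsSmoothProjective (n + E.dim) (X ⊗ E.X) := IsSmoothProjective.tensor_holds hX hE
    have hA' : (A.prod E).dim = n + E.dim := by rw [AbelianVariety.dim_prod, hA]
    have eA' : (A.prod E).X ≅ X ⊗ E.X := whiskerRightIso eA E.X
    have hη' := isPolarizationClass_boxSum hX hE hη hKE
    -- the b02-lift of `c` is primitive of defect `r`, rational, `(p+1,p+1)` on `X × E`, and `(p + 1) + r ≤ M`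
    have hz := ih hX' (A.prod E) hA' eA' hη' (p := p + 1) (by omega) (by omega) (by omega) _
      (isRationalClass_primitiveLift E η K_E hη.isRationalClass hKE.isRationalClass hc (r + 1))
      (isOfHodgeType_primitiveLift E η K_E hX hη.mem_algebraicClasses hKE.mem_algebraicClasses hpp (r + 1))
      (primitiveLift_mem_primitiveClasses E η K_E hE1 hn hprim)
    -- descend (slice `X ≅ X × {t}` and Lieberman's `A(X)` for the abelian `X`)
    exact mem_algebraicClasses_of_primitiveLift_mem E η K_E hX hA eA hη hn _ hz

/-- **The layers `m ≤ M` give the Hodge conjecture for every complex abelian variety of dimension `≤ M + 2`** (fact-free):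
by part XIV (`hodgeConjectureFor_iff_forall_mem_primitiveClasses`: Lefschetz `(1,1)`, hard Lefschetz and the Lefschetz
decomposition are theorems of the tree) it suffices to treat the Λ-primitive rational `(p,p)` classes with `2 ≤ p`,
`2p ≤ dim A`; such a class has defect `d = dim A − 2p` and `p + d = dim A − p ≤ dim A − 2 ≤ M`, so §1 applies.
[cite: VoisinHodgeI2002, Thm. 6.25, Cor. 6.26, Rem. 6.27 and Thm. 11.30] [cite: BrosnanFangNiePearlstein2009, §6 Lemma 48] -/
theorem hodgeConjectureFor_of_primitiveMiddle_le (M : ℕ) (hpm : PM⦃≤M⦄) (A : AbelianVariety ℂ) (hA : A.dim ≤ M + 2) :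
    HodgeConjectureFor A.dim A.X := by
  have hX : IsSmoothProjective A.dim A.X := AbelianVariety.isSmoothProjective_holds
  obtain ⟨Λ⟩ := nonempty_hardLefschetzNFold_holds A.dim A.X hX
  refine (hodgeConjectureFor_iff_forall_mem_primitiveClasses hX Λ).2 fun p h2 h2p c hc hpp hprim ↦ ?_
  refine mem_algebraicClasses_of_mem_primitiveClasses_of_primitiveMiddle_le M ?_ (A.dim - 2 * p) hX A rfl (Iso.refl A.X)
    Λ.isPolarizationClass h2 (by omega) (by omega) c hc hpp hprim
  intro B m h2m hmM hB θ hθ z hz hzt hzprim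
  obtain ⟨Λ', rfl⟩ := hθ.exists_hardLefschetzNFold (AbelianVariety.isSmoothProjective_holds (A := B))
  exact hpm B Λ' m h2m hmM hB z hz hzt hzprim

/-! ## §2 The layer calculus (fact-free, `HC_CM`-free) -/
/-- **`PM⦃≤M⦄ ⟹ HCUpToDim (M + 2)`**, NO named fact. [cite: VoisinHodgeI2002, Cor. 6.26, Rem. 6.27 and Thm. 11.30]
[cite: BrosnanFangNiePearlstein2009, §6 Lemma 48] -/
theorem hcUpToDim_of_primitiveMiddle_le (M : ℕ) (hpm : PM⦃≤M⦄) : HCUpToDim (M + 2) :=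
  fun A hA ↦ hodgeConjectureFor_of_primitiveMiddle_le M hpm A hA

/-- **`HCUpToDim (2M) ⟹ PM⦃≤M⦄`** (restriction), NO fact. [folklore] -/
theorem primitiveMiddle_le_of_hcUpToDim (M : ℕ) (h : HCUpToDim (2 * M)) : PM⦃≤M⦄ :=
  fun A _ m _ hmM hA c hc hpp _ ↦ (h A (by omega)).2 m c hc hpp

/-- `PM⦃≤2⦄ ↔ PM⦃=2⦄` (the only layer below `2` is `2`), NO fact. [folklore] -/
theorem primitiveMiddle_le_two_iff_eq_two : PM⦃≤2⦄ ↔ PM⦃=2⦄ := by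
  refine ⟨fun h A Λ hA c hc hpp hprim ↦ h A Λ 2 le_rfl le_rfl hA c hc hpp hprim, fun h A Λ m h2 hm2 hA c hc hpp hprim ↦ ?_⟩
  obtain rfl : m = 2 := le_antisymm hm2 h2
  exact h A Λ hA c hc hpp hprim

/-- The ladder step `PM⦃≤M+1⦄ ↔ PM⦃≤M⦄ ∧ PM⦃=M+1⦄` (`1 ≤ M`), NO fact. [folklore] -/
theorem primitiveMiddle_le_succ_iff (M : ℕ) (hM : 1 ≤ M) : PM⦃≤(M + 1)⦄ ↔ PM⦃≤M⦄ ∧ PM⦃=(M + 1)⦄ := by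
  refine ⟨fun h ↦ ⟨fun A Λ m h2 hmM hA c hc hpp hprim ↦ h A Λ m h2 (by omega) hA c hc hpp hprim,
    fun A Λ hA c hc hpp hprim ↦ h A Λ (M + 1) (by omega) le_rfl hA c hc hpp hprim⟩, fun h A Λ m h2 hm hA c hc hpp hprim ↦ ?_⟩
  rcases Nat.lt_or_ge m (M + 1) with hlt | hge
  · exact h.1 A Λ m h2 (by omega) hA c hc hpp hprim
  · obtain rfl : m = M + 1 := le_antisymm hm hge
    exact h.2 A Λ hA c hc hpp hprim

/-- **`HCUpToDim 4 ↔ PM⦃=2⦄`: THE HODGE CONJECTURE FOR COMPLEX ABELIAN FOURFOLDS (equivalently, for all complex abelian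
varieties of dimension `≤ 4`) IS EXACTLY THE FOURFOLD LAYER** — every rational `(2,2)` Λ-primitive class on every complex
abelian fourfold is algebraic, for every hard Lefschetz datum `Λ` — NO named fact (`M = 2` of the sandwich: `2M = M + 2 = 4`).
[cite: VoisinHodgeI2002, Cor. 6.26, Rem. 6.27 and Thm. 11.30] [cite: MoonenZarhin1999LowDim, §1 (1.4) and Thm. 0.1 (setting);
arXiv:math/9901113] -/
theorem hcUpToDim_four_iff_primitiveMiddle_two : HCUpToDim 4 ↔ PM⦃=2⦄ :=
  ⟨fun h ↦ primitiveMiddle_le_two_iff_eq_two.1 (primitiveMiddle_le_of_hcUpToDim 2 h),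
    fun h ↦ hcUpToDim_of_primitiveMiddle_le 2 (primitiveMiddle_le_two_iff_eq_two.2 h)⟩

/-- The same on the row `g = 4`: `HCAtDim 4 ↔ PM⦃=2⦄`, NO named fact. [cite: VoisinHodgeI2002, Cor. 6.26 and Thm. 11.30] -/
theorem hcAtDim_four_iff_primitiveMiddle_two : HCAtDim 4 ↔ PM⦃=2⦄ :=
  (hcUpToDim_iff_hcAtDim 4).symm.trans hcUpToDim_four_iff_primitiveMiddle_two

/-- **`PM⦃≤3⦄ ⟹ HCUpToDim 5`: the fourfold and SIXFOLD layers give the Hodge conjecture for every complex abelian variety of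
dimension `≤ 5`**, NO named fact (`M = 3`): a codimension-`2` class on a FIVEFOLD lifts to a primitive `(3,3)` class on a
sixfold `A × E` — on the level of use the sixfold layer replaces Moonen–Zarhin's fivefold classification Thm. 0.2 (which it
does NOT reprove). [cite: VoisinHodgeI2002, Cor. 6.26, Rem. 6.27 and Thm. 11.30] [cite: MoonenZarhin1999LowDim, Thm. 0.2
(contrast); arXiv:math/9901113] [cite: BrosnanFangNiePearlstein2009, §6 Lemma 48] -/
theorem hcUpToDim_five_of_primitiveMiddle_le_three (h : PM⦃≤3⦄) : HCUpToDim 5 :=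
  hcUpToDim_of_primitiveMiddle_le 3 h

/-- **Row `g ≤ 5` from row `g = 4` and the SIXFOLD layer alone**, NO named fact: `HCAtDim 4 → PM⦃=3⦄ → HCUpToDim 5`.
[cite: VoisinHodgeI2002, Cor. 6.26, Rem. 6.27 and Thm. 11.30] [cite: BrosnanFangNiePearlstein2009, §6 Lemma 48] -/
theorem hcUpToDim_five_of_hcAtDim_four_of_primitiveMiddle_three (h4 : HCAtDim 4) (h6 : PM⦃=3⦄) : HCUpToDim 5 :=
  hcUpToDim_five_of_primitiveMiddle_le_three
    ((primitiveMiddle_le_succ_iff 2 (by norm_num)).2 ⟨primitiveMiddle_le_two_iff_eq_two.2 (hcAtDim_four_iff_primitiveMiddle_two.1 h4), h6⟩)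

/-! ## §3 The first open layer: `HC_AV` is the fourfold row plus the layers `m ≥ 3` (fact-free), and modulo print -/

/-- **`HC_AV ↔ PM⦃≤2⦄ ∧ PM⦃≥3⦄`** (split part XXVIII's normal form at `m = 3`), NO named fact. [cite: VoisinHodgeI2002, Cor. 6.26
and Rem. 6.27] -/
theorem HC_AV_iff_primitiveMiddle_le_two_and_ge_three : HodgeAbelianVarieties ↔ PM⦃≤2⦄ ∧ PM⦃≥3⦄ := by
  rw [HC_AV_iff_forall_primitiveMiddle]
  refine ⟨fun h ↦ ⟨fun A Λ m h2 _ hA c hc hpp hprim ↦ h A Λ m h2 hA c hc hpp hprim,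
    fun A Λ m h2 _ hA c hc hpp hprim ↦ h A Λ m h2 hA c hc hpp hprim⟩, fun h A Λ m h2 hA c hc hpp hprim ↦ ?_⟩
  rcases Nat.lt_or_ge m 3 with hlt | hge
  · exact h.1 A Λ m h2 (by omega) hA c hc hpp hprim
  · exact h.2 A Λ m h2 hge hA c hc hpp hprim

/-- **`HC_AV ↔ HCAtDim 4 ∧ PM⦃≥3⦄`: THE HODGE CONJECTURE FOR ALL COMPLEX ABELIAN VARIETIES IS THE ROW `g = 4` PLUS THE
PRIMITIVE MIDDLE LAYERS OF THE ABELIAN VARIETIES OF EVEN DIMENSION `≥ 6`**, NO named fact — odd dimensions, non-primitive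
classes, non-middle degrees and the row `g = 5` are eliminated fact-free. [cite: VoisinHodgeI2002, Cor. 6.26, Rem. 6.27 and
Thm. 11.30] [cite: BrosnanFangNiePearlstein2009, §6 Lemma 48] -/
theorem HC_AV_iff_hcAtDim_four_and_primitiveMiddle_ge_three : HodgeAbelianVarieties ↔ HCAtDim 4 ∧ PM⦃≥3⦄ :=
  HC_AV_iff_primitiveMiddle_le_two_and_ge_three.trans
    (and_congr_left' (primitiveMiddle_le_two_iff_eq_two.trans hcAtDim_four_iff_primitiveMiddle_two.symm))

/-- Under the row `g = 4` alone: `HC_AV ↔ PM⦃≥3⦄`, NO named fact. [cite: VoisinHodgeI2002, Cor. 6.26 and Rem. 6.27] -/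
theorem HC_AV_iff_primitiveMiddle_ge_three_of_hcAtDim_four (h4 : HCAtDim 4) : HodgeAbelianVarieties ↔ PM⦃≥3⦄ :=
  HC_AV_iff_hcAtDim_four_and_primitiveMiddle_ge_three.trans ⟨fun h ↦ h.2, fun h ↦ ⟨h4, h⟩⟩

/-- **A counterexample to `HC_AV`, if any, lives — given the row `g = 4` — in the primitive middle cohomology of an abelian
variety of EVEN dimension `≥ 6`**, NO named fact. [cite: VoisinHodgeI2002, Cor. 6.26 and Rem. 6.27] -/
theorem not_HC_AV_iff_exists_primitiveMiddle_ge_three_not_mem_of_hcAtDim_four (h4 : HCAtDim 4) :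
    ¬ HodgeAbelianVarieties ↔
      ∃ (A : AbelianVariety ℂ) (Λ : HardLefschetzNFold A.dim A.X) (m : ℕ), 3 ≤ m ∧ A.dim = 2 * m ∧
        ∃ c : complexBetti A.X (2 * m), IsRationalClass c ∧ IsOfHodgeType A.dim A.X (2 * m) m m c ∧
          c ∈ primitiveClasses Λ.hyperplaneClass A.dim (2 * m) ∧ c ∉ algebraicClasses A.X m := by
  rw [HC_AV_iff_primitiveMiddle_ge_three_of_hcAtDim_four h4]
  constructor
  · intro h
    by_contra hne
    exact h fun A Λ m _ h3 hA c hc hpp hprim ↦ by_contra fun hnc ↦ hne ⟨A, Λ, m, h3, hA, c, hc, hpp, hprim, hnc⟩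
  · rintro ⟨A, Λ, m, h3, hA, c, hc, hpp, hprim, hnc⟩ h
    exact hnc (h A Λ m (by omega) h3 hA c hc hpp hprim)

/-- **MOD ONE REFEREED FACT (`h01` = Moonen–Zarhin 1999 Thm. 0.1, displayed): the fourfold layer IS the Weil-fourfold cell**,
`PM⦃=2⦄ ↔ Markman2025_weilClasses_algebraic_abelianFourfold` (through typer 1's row `hcUpToDim_four_iff_weilClassesFourfolds`).
[cite: MoonenZarhin1999LowDim, Thm. 0.1 with (1.4), (1.9); arXiv:math/9901113] [cite: Markman2025SecantWeil, Cor. 1.6.1]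
[cite: Schoen1988HodgeWeil, Thm.] [cite: vanGeemen1994HodgeAV, §7.1–7.2 and §7.4] -/
theorem primitiveMiddle_two_iff_weilClassesFourfolds_of_moonenZarhin
    (h01 : MoonenZarhin1999_codimTwoHodgeClasses_abelianFourfold) :
    PM⦃=2⦄ ↔ Markman2025_weilClasses_algebraic_abelianFourfold :=
  hcUpToDim_four_iff_primitiveMiddle_two.symm.trans (hcUpToDim_four_iff_weilClassesFourfolds h01)

/-- **HEADLINE, MOD ONE REFEREED FACT (`h01`, displayed): `HC_AV ↔ Markman2025_weilClasses_algebraic_abelianFourfold ∧ PM⦃≥3⦄`**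
— Hodge for ALL complex abelian varieties is the Weil-FOURFOLD cell (hodge-weil rung R1; UNREFEREED in print for general
discriminant) AND the primitive middle layers of even dimension `≥ 6`; no other classification fact, no `HC_CM`.
[cite: MoonenZarhin1999LowDim, Thm. 0.1; arXiv:math/9901113] [cite: Markman2025SecantWeil, Cor. 1.6.1]
[cite: Markman2025SurveySecant, Thm. 1.2 and Cor. 1.3] [cite: VoisinHodgeI2002, Cor. 6.26 and Rem. 6.27] -/
theorem HC_AV_iff_weilClassesFourfolds_and_primitiveMiddle_ge_three_of_moonenZarhin
    (h01 : MoonenZarhin1999_codimTwoHodgeClasses_abelianFourfold) :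
    HodgeAbelianVarieties ↔ Markman2025_weilClasses_algebraic_abelianFourfold ∧ PM⦃≥3⦄ :=
  HC_AV_iff_hcAtDim_four_and_primitiveMiddle_ge_three.trans
    (and_congr_left' ((hcUpToDim_iff_hcAtDim 4).symm.trans (hcUpToDim_four_iff_weilClassesFourfolds h01)))

/-- MOD `h01` AND the Weil-fourfold cell `hW` (both displayed; `hW` UNREFEREED in general): `HC_AV ↔ PM⦃≥3⦄` — what is left of
Hodge for abelian varieties is the primitive middle cohomology in even dimension `≥ 6`. [cite: MoonenZarhin1999LowDim, Thm. 0.1]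
[cite: Markman2025SecantWeil, Cor. 1.6.1] [cite: VoisinHodgeI2002, Cor. 6.26 and Rem. 6.27] -/
theorem HC_AV_iff_primitiveMiddle_ge_three_of_moonenZarhin_of_weilClassesFourfolds
    (h01 : MoonenZarhin1999_codimTwoHodgeClasses_abelianFourfold) (hW : Markman2025_weilClasses_algebraic_abelianFourfold) :
    HodgeAbelianVarieties ↔ PM⦃≥3⦄ :=
  (HC_AV_iff_weilClassesFourfolds_and_primitiveMiddle_ge_three_of_moonenZarhin h01).trans ⟨fun h ↦ h.2, fun h ↦ ⟨hW, h⟩⟩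

/-- MOD `h01`, `hW` (displayed): **the SIXFOLD layer alone gives every abelian variety of dimension `≤ 5`** — `PM⦃=3⦄ → HCUpToDim 5`
with Moonen–Zarhin Thm. 0.2 NOT among the inputs (contrast typer 1's `hcUpToDim_five_of_codimTwoFacts_of_weilClassesFourfolds`).
[cite: MoonenZarhin1999LowDim, Thms. 0.1, 0.2 (contrast); arXiv:math/9901113] [cite: Markman2025SecantWeil, Cor. 1.6.1]
[cite: BrosnanFangNiePearlstein2009, §6 Lemma 48] -/
theorem hcUpToDim_five_of_primitiveMiddle_three_of_moonenZarhin_of_weilClassesFourfolds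
    (h01 : MoonenZarhin1999_codimTwoHodgeClasses_abelianFourfold) (hW : Markman2025_weilClasses_algebraic_abelianFourfold)
    (h6 : PM⦃=3⦄) : HCUpToDim 5 :=
  hcUpToDim_five_of_hcAtDim_four_of_primitiveMiddle_three
    (hcAtDim_of_hcUpToDim ((hcUpToDim_four_iff_weilClassesFourfolds h01).2 hW)) h6

/-- MOD THE HODGE-WEIL LADDER'S FINEST TYPED INPUTS (all displayed, none asserted): `h01` (refereed), Markman's hyperbolic
SIXFOLDS of discriminant `-1` (`Markman2025_weilClasses_algebraic_hyperbolicSixfold`, arXiv:2502.03415 Thm. 1.5.1, UNREFEREED)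
and Schoen's product-surface degeneration (`Schoen1998_weilClasses_algebraic_of_prod_surface`, refereed); the third sixfold
input F0c is the tree's theorem `Markman2025_exists_weilTypeSurface_prod_isHyperbolicWeilType_holds`. Then `HC_AV ↔ PM⦃≥3⦄`.
[cite: Markman2025SecantWeil, Thm. 1.5.1 and Cor. 1.6.1] [cite: Schoen1998HodgeWeilAddendum, §10] [cite: MoonenZarhin1999LowDim, Thm. 0.1] -/
theorem HC_AV_iff_primitiveMiddle_ge_three_of_moonenZarhin_of_hyperbolicSixfolds_of_schoen
    (h01 : MoonenZarhin1999_codimTwoHodgeClasses_abelianFourfold) (h₁ : Markman2025_weilClasses_algebraic_hyperbolicSixfold)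
    (h₃ : Schoen1998_weilClasses_algebraic_of_prod_surface) : HodgeAbelianVarieties ↔ PM⦃≥3⦄ :=
  HC_AV_iff_primitiveMiddle_ge_three_of_moonenZarhin_of_weilClassesFourfolds h01
    (Markman2025_weilClasses_algebraic_abelianFourfold_holds_of h₁
      Markman2025_exists_weilTypeSurface_prod_isHyperbolicWeilType_holds h₃)

/-! ## §4 The anchored floor read on the first open layer — display-only, NO node (`HC_CM` enters here only) -/

/-- Display-only shape (NO `def`; census-invisible by design): part XXVIII's `F_CM⦃prim,mid⦄` RESTRICTED to `m ≥ 3` — every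
rational `(m,m)` Λ-primitive NON-algebraic middle-degree class on an abelian variety of even dimension `2m ≥ 6` admits an
anchored datum (part VII §A) with a CM fibre at which `W` is NOT algebraic. -/
local notation3 (prettyPrint := false) "F_CM⦃prim,mid,≥3⦄" =>
  ∀ (A : AbelianVariety ℂ), IsSmoothProjective (AbelianVariety.dim A) (AbelianVariety.X A) →
    ∀ (Λ : HardLefschetzNFold (AbelianVariety.dim A) (AbelianVariety.X A)) (m : ℕ), 3 ≤ m →
      AbelianVariety.dim A = 2 * m →
        ∀ (c : complexBetti (AbelianVariety.X A) (2 * m)), IsRationalClass c →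
          IsOfHodgeType (AbelianVariety.dim A) (AbelianVariety.X A) (2 * m) m m c →
            c ∈ primitiveClasses (HardLefschetzNFold.hyperplaneClass Λ) (AbelianVariety.dim A) (2 * m) →
              c ∉ algebraicClasses (AbelianVariety.X A) m →
                ∃ (n : ℕ) (𝒳 S : SchemeOver ℂ) (f : 𝒳 ⟶ S) (s : ComplexPoints S) (W : complexBetti 𝒳 (2 * m)),
                  IsCMAnchoredDatumFor A m c f n s W ∧
                    ∃ s' ∈ cmLocus f n,
                      complexBetti.map (fiberι f s') (2 * m) W ∉ algebraicClasses (fiberOver f s') m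

/-- **`F_CM^mid ⟹ F_CM⦃prim,mid,≥3⦄`** (from the B_min of record N104), NO fact: forget primitivity and `m = 2`. [folklore] -/
theorem primitiveMiddleSpreadingGeThree_of_middleHodgeFailureSpreadsToCMFibre (h : MiddleHodgeFailureSpreadsToCMFibre) :
    F_CM⦃prim,mid,≥3⦄ :=
  fun A hA _ m h3 hm c hc hpp _ hnc ↦ h A hA m (by omega) hm c hc hpp hnc

/-- ON-PATH, NO fact: `HC_AV ⟹ F_CM⦃prim,mid,≥3⦄` (nothing triggers it). [folklore] -/
theorem primitiveMiddleSpreadingGeThree_of_HC_AV (hAV : HodgeAbelianVarieties) : F_CM⦃prim,mid,≥3⦄ :=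
  fun A _ _ m _ _ c hc hpp _ hnc ↦ absurd ((hAV A).2 m c hc hpp) hnc

/-- **CLOSING ON THE FIRST OPEN LAYER: `HC_CM → HCAtDim 4 → F_CM⦃prim,mid,≥3⦄ → HC_AV`**, NO named fact. By §3 it suffices to
treat a rational `(m,m)` Λ-primitive middle class on an abelian variety of dimension `2m ≥ 6`; were it not algebraic, the
premise gives an anchored datum and a CM fibre where `W` is NOT algebraic, while `HC_CM` makes `W` algebraic at every CM fibre
(part VII) — contradiction. [cite: Deligne1982HodgeCycles, §6 proof of Thm. 2.11 (pp. 71–73)] [cite: Milne1999, §7 p. 72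
(hypothesis (H))] [cite: BrosnanFangNiePearlstein2009, §6 Lemma 48] -/
theorem HC_AV_of_HC_CM_of_hcAtDim_four_of_primitiveMiddleSpreadingGeThree (hCM : CMAbelianHodge) (h4 : HCAtDim 4)
    (h : F_CM⦃prim,mid,≥3⦄) : HodgeAbelianVarieties := by
  refine (HC_AV_iff_primitiveMiddle_ge_three_of_hcAtDim_four h4).2 fun A Λ m _ h3 hA c hc hpp hprim ↦ ?_
  by_contra hnc
  obtain ⟨n, 𝒳, S, f, s, W, hd, s', hs', hns'⟩ :=
    h A (AbelianVariety.isSmoothProjective_holds (A := A)) Λ m h3 hA c hc hpp hprim hnc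
  exact hns' (forall_cmLocus_mem_algebraicClasses_of_HC_CM_of_isCMAnchoredDatumFor hCM hd s' hs')

/-- **EXACTNESS ON THE FIRST OPEN LAYER, NO named fact: `HC_AV ↔ HCAtDim 4 ∧ (HC_CM ∧ F_CM⦃prim,mid,≥3⦄)`.** [folklore] -/
theorem HC_AV_iff_hcAtDim_four_and_HC_CM_and_primitiveMiddleSpreadingGeThree :
    HodgeAbelianVarieties ↔ HCAtDim 4 ∧ (CMAbelianHodge ∧ F_CM⦃prim,mid,≥3⦄) :=
  ⟨fun h ↦ ⟨hcOnClass_of_hodgeAbelianVarieties _ h, Ring2.Deform.HC_CM_of_HC_AV h, primitiveMiddleSpreadingGeThree_of_HC_AV h⟩,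
    fun h ↦ HC_AV_of_HC_CM_of_hcAtDim_four_of_primitiveMiddleSpreadingGeThree h.2.1 h.1 h.2.2⟩

/-- Hence `HCAtDim 4 ∧ F_CM⦃prim,mid,≥3⦄ ⟹ CMToAbelian` outright (a typed conditional TOWARD stmt-HodgeConjecture-16267, which
stays OPEN), NO named fact. [folklore] -/
theorem cmToAbelian_of_hcAtDim_four_of_primitiveMiddleSpreadingGeThree (h4 : HCAtDim 4) (h : F_CM⦃prim,mid,≥3⦄) :
    CMToAbelian :=
  fun hCM A _ ↦ HC_AV_of_HC_CM_of_hcAtDim_four_of_primitiveMiddleSpreadingGeThree hCM h4 h A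

/-- **MOD ONE REFEREED FACT (`h01`, displayed): `HC_AV ↔ Markman2025_weilClasses_algebraic_abelianFourfold ∧ (HC_CM ∧ F_CM⦃prim,mid,≥3⦄)`**
— the brief's shape `HC_CM → B → HC_AV` with `B` read as "the Weil-fourfold cell ∧ anchored spreading for primitive middle
classes in even dimension `≥ 6`"; `B` is NOT a node and NOT claimed minimal (the B_min of record stays N104).
[cite: MoonenZarhin1999LowDim, Thm. 0.1; arXiv:math/9901113] [cite: Markman2025SecantWeil, Cor. 1.6.1]
[cite: Deligne1982HodgeCycles, §6 proof of Thm. 2.11 (pp. 71–73)] -/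
theorem HC_AV_iff_weilClassesFourfolds_and_HC_CM_and_primitiveMiddleSpreadingGeThree_of_moonenZarhin
    (h01 : MoonenZarhin1999_codimTwoHodgeClasses_abelianFourfold) :
    HodgeAbelianVarieties ↔ Markman2025_weilClasses_algebraic_abelianFourfold ∧ (CMAbelianHodge ∧ F_CM⦃prim,mid,≥3⦄) :=
  HC_AV_iff_hcAtDim_four_and_HC_CM_and_primitiveMiddleSpreadingGeThree.trans
    (and_congr_left' ((hcUpToDim_iff_hcAtDim 4).symm.trans (hcUpToDim_four_iff_weilClassesFourfolds h01)))

/-! ## §5 Summary row (fact-free) -/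
/-- **THE LAYERED READING IN ONE ROW**, NO named fact: `HCUpToDim 4 ↔ PM⦃=2⦄`, `PM⦃≤3⦄ → HCUpToDim 5`,
`HC_AV ↔ HCAtDim 4 ∧ PM⦃≥3⦄`, `HC_AV ↔ HCAtDim 4 ∧ (HC_CM ∧ F_CM⦃prim,mid,≥3⦄)`; nothing here is "minimal". [folklore] -/
theorem spreadFloor_primitiveMiddle_layers_reading :
    (HCUpToDim 4 ↔ PM⦃=2⦄) ∧ (PM⦃≤3⦄ → HCUpToDim 5) ∧ (HodgeAbelianVarieties ↔ HCAtDim 4 ∧ PM⦃≥3⦄) ∧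
      (HodgeAbelianVarieties ↔ HCAtDim 4 ∧ (CMAbelianHodge ∧ F_CM⦃prim,mid,≥3⦄)) :=
  ⟨hcUpToDim_four_iff_primitiveMiddle_two, hcUpToDim_five_of_primitiveMiddle_le_three,
    HC_AV_iff_hcAtDim_four_and_primitiveMiddle_ge_three, HC_AV_iff_hcAtDim_four_and_HC_CM_and_primitiveMiddleSpreadingGeThree⟩

/-! ## Audit (kernel-checked): closures are EXACTLY the three standard axioms; `h01`, `hW`, `h₁`, `h₃`, `HC_CM` are binders -/

/-- info: 'Summit.HodgeConjecture.HodgeConjecture.Ring2.AbelianAll.mem_algebraicClasses_of_mem_primitiveClasses_of_primitiveMiddle_le' depends on axioms: [propext, Classical.choice, Quot.sound] -/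
#guard_msgs (whitespace := lax) in
#print axioms mem_algebraicClasses_of_mem_primitiveClasses_of_primitiveMiddle_le
/-- info: 'Summit.HodgeConjecture.HodgeConjecture.Ring2.AbelianAll.hcUpToDim_four_iff_primitiveMiddle_two' depends on axioms: [propext, Classical.choice, Quot.sound] -/
#guard_msgs (whitespace := lax) in
#print axioms hcUpToDim_four_iff_primitiveMiddle_two
/-- info: 'Summit.HodgeConjecture.HodgeConjecture.Ring2.AbelianAll.HC_AV_iff_hcAtDim_four_and_primitiveMiddle_ge_three' depends on axioms: [propext, Classical.choice, Quot.sound] -/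
#guard_msgs (whitespace := lax) in
#print axioms HC_AV_iff_hcAtDim_four_and_primitiveMiddle_ge_three
/-- info: 'Summit.HodgeConjecture.HodgeConjecture.Ring2.AbelianAll.HC_AV_iff_weilClassesFourfolds_and_primitiveMiddle_ge_three_of_moonenZarhin' depends on axioms: [propext, Classical.choice, Quot.sound] -/
#guard_msgs (whitespace := lax) in
#print axioms HC_AV_iff_weilClassesFourfolds_and_primitiveMiddle_ge_three_of_moonenZarhin
/-- info: 'Summit.HodgeConjecture.HodgeConjecture.Ring2.AbelianAll.HC_AV_iff_hcAtDim_four_and_HC_CM_and_primitiveMiddleSpreadingGeThree' depends on axioms: [propext, Classical.choice, Quot.sound] -/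
#guard_msgs (whitespace := lax) in
#print axioms HC_AV_iff_hcAtDim_four_and_HC_CM_and_primitiveMiddleSpreadingGeThree

end Summit.HodgeConjecture.HodgeConjecture.Ring2.AbelianAll
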